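import Mathlib.NumberTheory.Cyclotomic.Basic
import Literature.NumberTheory.EllipticCurves.IwasawaSelmerEigen
import Literature.NumberTheory.EllipticCurves.SelmerPInftyRestriction
import Literature.NumberTheory.EllipticCurves.Wuthrich2014.ReducibleDivisibilityCyclotomicThree
import Literature.NumberTheory.EllipticCurves.PAdicLFunctionMinusMult
import HarnessLib

/-!
# Wuthrich 2014, Thm. 16 at `p = 3`, the `ω`-COMPONENT: `char_{Λ(Γ)} (e_ω X(E/ℚ(ζ_{3^∞}))) ∋ u · L₃(E, ω, T)`
# for `E` semistable at `3` with `E[3]` reducible (named fact; the componentwise form of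
# `charIdeal_dvd_padicLFunction_cyclotomicThree` and its multiplicative siblings)

Source: C. Wuthrich, *On the integrality of modular symbols and Kato's Euler system for elliptic
curves*, Doc. Math. 19 (2014) 381–402 [Wuthrich2014]. **Theorem 16** (p. 397): "Let `E/ℚ` be an
elliptic curve and let `p > 2` be a prime. Suppose that `E` has semi-stable reduction at `p` and that
`E[p]` is reducible as a `G_ℚ`-module. Then `char_Λ X(E)` divides the ideal generated by `L_p(E)`. If
the reduction of `E` is split multiplicative at `p`, then `I · char_Λ X(E)` divides the ideal
generated by `L_p(E)`, where `I` is the kernel of the homomorphism `Λ → ℤ_p` that sends all elements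
of [the group to `1`]." §1 Thm. 3 (p. 383): "We formulate it here for the full cyclotomic
`ℤ_p^×`-extension." §3 (p. 390): "Any `Λ`-module `M` comes equipped with an action by the group
`Δ = Gal(ℚ(ζ_p)/ℚ)` and we split `M` up into the eigenspaces `M = ⊕_{i=0}^{p−2} M_i` where `Δ` acts
on `M_i = M(−i)^Δ` by the `i`-th power of the Teichmüller character" (and Lemma 10, loc. cit., works
with the components `H¹(T_pE)_i` "free of rank 1 over `Λ(Γ)`"). §5 (p. 397): "The Selmer group [of]
`E` over `ℚ(ζ_{p^n})` is defined as usual as the elements in [`H¹`] that are locally in the image of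
the points. […] We denote the dual of the limit of the Selmer group by `X(E)`; it is a finitely
generated `Λ`-module. If the reduction is good ordinary, theorem 17.4 in [Kato] shows that `X(E)` is
`Λ`-torsion. The same conclusion holds in general in our situation; see [Kobayashi 2006] for the
split multiplicative case." §4 (p. 396): "For any torsion `Λ`-module `M`, we define the
characteristic series `char_Λ(M)` as the product of the ideals `𝔭^{l_𝔭}` where
`l_𝔭 = length_{Λ_𝔭}(M_𝔭)` as `𝔭` runs through all primes of height `1` in `Λ`." Cor. 18 (p. 398):
"`L_p(E)` belongs to `Λ` for all elliptic curves `E/ℚ` with semi-stable reduction at `p > 2`."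
Torsion over the abelian base `ℚ(ζ₃)` also: R. Greenberg, LNM 1716 (1999) Thm. 1.5 (Kato–Rohrlich),
PDF p. 61. The eigenspace descent display: Greenberg, LNM 1716 §5, p. 143 ("`X` and `Y` are
`Λ[Δ]`-modules … `S'_C(ℚ_∞) ≅ Hom_Δ(Y, C) = Hom(Y^θ, C)`").

ONE NAMED FACT (`def … : Prop`, nothing asserted, D-0014/D-0026): Theorem 16 at `p = 3` READ ON THE
`ω`-EIGENCOMPONENT ALONE — the reading that the accepted siblings
`charIdeal_dvd_padicLFunction_cyclotomicThree` (p206900, good ordinary; referee R94.2, flag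
`Wu14-Thm16-p3-branch-split`), `thm16_charIdeal_dvd_nonsplitMultiplicative_cyclotomicThree` (p217659)
and `thm16_charIdeal_dvd_splitMultiplicative_cyclotomicThree` (p218971) pass through BEFORE
multiplying the two components ("the printed divisibility says `e_± L_p(E) ∈ char(e_± X)`, whence —
characteristic ideals being multiplicative over `X = e₊X ⊕ e₋X` — …"): here we STOP at
`e₋ L_p(E) ∈ char_{Λ(Γ)}(e₋ X)`, i.e. ONE STEP EARLIER, and transcribe it in the tree's SUBGROUP
model of Selmer groups over `Γ_ℚ` with the eigen-vocabulary of `IwasawaSelmerEigen`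
(`WeierstrassCurve.eigenSelmerGroupOver`, `WeierstrassCurve.EigenSelmerDualData`; Greenberg §5
p. 143, Wuthrich §3 p. 390).

## The reading (why this transcription is verbatim up to semisimple bookkeeping)

`Λ = ℤ₃⟦G⟧`, `G = Gal(ℚ(ζ_{3^∞})/ℚ) ≅ ℤ₃^× = Δ × Γ`, `Δ = Gal(ℚ(ζ₃)/ℚ) = {1, c}`, `Γ = 1 + 3ℤ₃`;
`Λ = Λ(Γ)e₊ ⊕ Λ(Γ)e₋` with `e_± = (1 ± [c])/2` (`3 ∤ #Δ = 2`), every `Λ`-module is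
`M = M₀ ⊕ M₁ = e₊M ⊕ e₋M` (p. 390), the height-one primes of `Λ` are those of the two factors, so
`char_Λ(M) = char_{Λ(Γ)}(e₊M)e₊ + char_{Λ(Γ)}(e₋M)e₋` and "`char_Λ X(E)` divides the ideal generated
by `L_p(E)`" SAYS, component by component, `e₊L_p(E) ∈ char_{Λ(Γ)}(e₊X)` and
**`e₋L_p(E) ∈ char_{Λ(Γ)}(e₋X)`**. The split-multiplicative factor `I` (augmentation ideal of
`Λ(G)`) satisfies `e₋ ∈ I` (the augmentation kills `e₋ = (1 − [c])/2`), hence `e₋I = e₋Λ`: the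
`ω`-component of "`L_p(E) ∈ I · char X(E)`" is again `e₋L_p(E) ∈ char(e₋X)` — NO extra factor on
the odd component (the exceptional zero lives on `e₊`, where `e₊I = (T)`; cf. the split sibling).
`e₋L_p(E) ↔ L₃(E, ω, T) = ∫_{ℤ₃^×} ω(x)(1+T)^{ℓ(x)} dμ_E(x)`, the ODD tame branch of the
Néron-normalised Mazur–Swinnerton-Dyer / Mazur–Tate–Teitelbaum measure (MTT 1986 §I.13; built on the
MINUS modular symbols `[r]⁻_E` since `ω` is odd): for `3` good ordinary the two-term measure with the
unit root `α` (tree `padicLFunctionMinusBranch f α 1`), for `3` multiplicative the one-term measure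
(`ε(p) = 0`, MTT §I.10) with `α = a₃ = +1` (split) / `−1` (non-split) (tree
`padicLFunctionMinusBranchMult f (±1) 1`).

THE FIELD AND THE MODULE. For `p = 3`, `ℚ(ζ_{3^∞}) = K·ℚ_∞` with `K := ℚ(ζ₃) = ℚ(√−3)` and `ℚ_∞`
the cyclotomic `ℤ₃`-extension of `ℚ`: in the tree's subgroup model (file `SubgroupSelmer`:
`W.selmerGroupOver p H = Sel_{p^∞}(E/ℚ̄^H)`, local conditions "in the image of the points" at all
places — Wuthrich's Selmer group, p. 397), `Gal(ℚ̄/ℚ(ζ_{3^∞})) = ker κ ⊓ galRange K =: H` for `κ` THE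
cyclotomic `ℤ₃`-extension of `ℚ` (`κ.IsCyclotomic`) and `galRange K = Gal(ℚ̄/K)`, and
`Gal(ℚ̄/ℚ_∞) = ker κ =: H'`; `Δ ≅ H'/H` acts on `Sel_{3^∞}(E/ℚ(ζ_{3^∞})) = W.selmerGroupOver 3 H`
by the conjugation action `g_*` (`conjH1`), and the Teichmüller character `ω` of `Δ` (order `2`) is
`ω(g) = +1` for `g ∈ galRange K`, `−1` otherwise. So Wuthrich's `M₁` for `M` = the Selmer group is
`W.eigenSelmerGroupOver 3 H H' ω = {t ∈ Sel : g_* t = ω(g)·t ∀ g ∈ H'}` and, `3` being odd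
(`Hom(M, ℚ₃/ℤ₃)₁ = Hom(M₁, ℚ₃/ℤ₃)`, `Δ` of order `2` so no contragredient sign), `e₋X(E) = X(E)₁` is
the Pontryagin dual of `M₁` as a `Λ(Γ)`-module with `T = γ − 1` for `γ ∈ Gal(ℚ̄/K)` (so that `γ`
restricts into `Γ = Gal(ℚ(ζ_{3^∞})/ℚ(ζ₃))`, not merely into `G`) lifting the topological generator
`χ₃(γ) = 4 = 1 + 3` of `Γ` (`IsCyclotomicVariable 3 γ`: `χ₃(γ)·ζ = 4` with `ζ` torsion; here
`χ₃(γ) ≡ 1 (mod 3)` forces `ζ = 1`; `κ.IsTopGenerator γ` fixes the normalisation of `κ`) — which is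
EXACTLY a datum `D : W.EigenSelmerDualData 3 H H' ω γ` (`X ≅ Hom(M₁, ℚ/ℤ)`, `T ↔ γ_* − 1`,
constants through `ℤ₃ → ℤ/3^k`; file `IwasawaSelmerEigen`, the eigen-analogue of the tree's
`SelmerDualData` used by all three siblings).

PERIODS (the only translation made, as in the siblings): Wuthrich's `[r]⁻_E` is normalised by the
Néron period `Ω⁻_E` (p. 381), the tree's `ratMinusSymbol f` by `Ω⁻_f = minusPeriod f`; with
`ϖ' · |Ω⁻(E)| = Ω⁻_f` (`|Ω⁻(E)| = imaginaryPeriodRat`, Pal's imaginary Néron period, which differs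
from Wuthrich's `Ω⁻_E` by a power of `2`), `L₃(E, ω, T)` (Néron-normalised) is
`u · ϖ' · L⁻` for the tree's odd branch `L⁻` and a `3`-adic unit `u` (signs, powers of `2`), kept
explicit. Only `ϖ'` enters (no `ϖ`, no `c_∞`: those belong to the even component).

Hypotheses transcribed: `E = V` globally minimal over `ℚ`; SEMISTABLE at `3`, as the disjunction of
the three local types each paired with ITS odd branch `L⁻` — good ordinary (`IsOrdinaryAt V 3`; for
`3` good with `E[3]` reducible the reduction is ordinary, §5 p. 397) with
`L⁻ = padicLFunctionMinusBranch f (unitRoot V 3) 1`, split multiplicative with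
`L⁻ = padicLFunctionMinusBranchMult f 1 1`, non-split multiplicative with
`L⁻ = padicLFunctionMinusBranchMult f (−1) 1`; `E[3]` reducible; `K = ℚ(ζ₃)`
(`IsCyclotomicExtension {3} ℚ K`, with `galRange K` normal in `Γ_ℚ` — automatic for the quadratic
`K`, carried as an instance for the vocabulary); `κ` cyclotomic with topological generator
`γ ∈ galRange K` matching the cyclotomic variable; `f` the newform of `E`; `D` an eigen-dual datum as
displayed; `ϖ'`. Conclusion: `e₋X` is `Λ(Γ)`-torsion (a direct summand of the torsion module `X(E)`,
§5 p. 397 / Greenberg Thm. 1.5) and `u · ϖ' · L⁻ = ι g` for some `g ∈ char_{Λ(Γ)}(e₋X)`, `u ∈ ℤ₃ˣ`,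
`ι = iwasawaToPowerSeries 3 : Λ ↪ ℚ₃⟦T⟧`. Proposed flag: `Wu14-Thm16-p3-branch-split` (the SAME
componentwise reading as p206900/p217659/p218971, one multiplication earlier; literature seat C163:
"print-faithful and finer"). What is NOT here: the even component (in the siblings), `p ≠ 3`, any
proof (Kato's Euler system is not in Mathlib). No `_holds` is to be expected.
-- TODO(general form): Thm. 16 componentwise for every odd `p` over `ℚ(μ_p)`: for each `i mod p − 1`,
-- `char_{Λ(Γ)}(e_i X(E/ℚ(μ_{p^∞}))) ∋ L_p(E, ω^i, T)` (with `e₀I = (T)` in the split case).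

Consumer: the BSD rank-≤1 residual cell (`b2b-bsdres`), sub-cell additive-p1, kernel brick 5
(`Summits/BirchSwinnertonDyer/Rank1Residual/AdditivePotMult/EigenLeadingTermInput.lean`,
`chiBranchLeadingTermOddAt_of_eigenLeadingTerm`): with the kernel transport
`Sel_{3^∞}(E ⊗ χ_K/ℚ_∞) ≅ Sel_{3^∞}(E/ℚ(ζ_{3^∞}))^{(ω)}` (`twistDescentEquiv`, `SelmerDualData.toChiEigen`)
and the `T = 0` value of the odd branch (MTT §I.14, tree theorems) this fact makes additive-p4's typed
input `ChiBranchLeadingTermOddAt W 3` a theorem for every `W`, hence the rank-`0` upper half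
`ord₃ #Ш(E) ≤ ord₃ #Ш_an(E)` for every curve of class X3♯(M) / X3♯(G-ord) (ADDITIVE, potentially
semistable-ordinary at `3`, `E[3]` reducible) from published theorems + kernel glue. HONEST FRAMING:
the cell deletes COMBINATION-SHAPED classes from published theorems and TYPES the construction-shaped
remainder; labels of X3/X4 unchanged by this file; nothing here is "finishing BSD".
-/

set_option autoImplicit false

noncomputable section

open scoped Classical MatrixGroups ModularForm

open CongruenceSubgroup WeierstrassCurve Literature.NumberTheory.EllipticCurves
  Literature.NumberTheory.EllipticCurves.ModularForms
  Literature.NumberTheory.GaloisRepresentations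

namespace Literature.NumberTheory.EllipticCurves.Wuthrich2014

/-- **Wuthrich 2014, Theorem 16 at `p = 3`, `E` semistable at `3`, `E[3]` reducible — the
`ω`-COMPONENT: `char_{Λ(Γ)}(e₋X(E/ℚ(ζ_{3^∞}))) ∋ u · L₃(E, ω, T)`.** As printed (Doc. Math. 19 (2014),
Thm. 16, p. 397): "Let `E/ℚ` be an elliptic curve and let `p > 2` be a prime. Suppose that `E` has
semi-stable reduction at `p` and that `E[p]` is reducible as a `G_ℚ`-module. Then `char_Λ X(E)` divides
the ideal generated by `L_p(E)`. If the reduction of `E` is split multiplicative at `p`, then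
`I · char_Λ X(E)` divides the ideal generated by `L_p(E)`" — `Λ = ℤ_p⟦Gal(ℚ(ζ_{p^∞})/ℚ)⟧` (§1 Thm. 3:
"for the full cyclotomic `ℤ_p^×`-extension"), `X(E)` the dual of `lim_n Sel(E/ℚ(ζ_{p^n}))` (§5
p. 397; `Λ`-torsion loc. cit. and Greenberg LNM 1716 Thm. 1.5), `char_Λ` the product over height-one
primes (§4 p. 396), `L_p(E) ∈ Λ` (Cor. 18) the Néron-normalised MTT measure, `I` the augmentation
ideal; §3 (p. 390): "we split `M` up into the eigenspaces `M = ⊕_{i=0}^{p−2} M_i` where `Δ` acts on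
`M_i` […] by the `i`-th power of the Teichmüller character". For `p = 3`: `Λ = Λ(Γ)e₊ ⊕ Λ(Γ)e₋`
(`Δ = {1, c}`), the height-one primes are those of the two factors, so the printed divisibility says
`e_±L_p(E) ∈ char_{Λ(Γ)}(e_±X)`; THIS FACT IS ITS `e₋`-HALF `L₃(E, ω, T) ∈ char_{Λ(Γ)}(e₋X)` (in the
split case `e₋ ∈ I`, `e₋I = e₋Λ`: no extra factor on the odd component), `L₃(E, ω, T)` the odd tame
branch (MTT §I.13, minus modular symbols) of the two-term measure with the unit root (good ordinary)
resp. the one-term measure with `α = a₃ = ±1` (multiplicative). Field and module: `ℚ(ζ_{3^∞}) = K·ℚ_∞`,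
`K = ℚ(ζ₃)`; in the tree's subgroup model `Gal(ℚ̄/ℚ(ζ_{3^∞})) = ker κ ⊓ galRange K` (`κ` the cyclotomic
`ℤ₃`-extension of `ℚ`), `Δ = ker κ/(ker κ ⊓ galRange K)` acts by `g_*`, `ω(g) = ±1` according as
`g ∈ galRange K`; `M₁ = eigenSelmerGroupOver V 3 (ker κ ⊓ galRange K) (ker κ) ω` and `e₋X = X₁` is its
Pontryagin dual with `T = γ − 1`, `γ ∈ Gal(ℚ̄/K)` lifting `χ₃(γ) = 4` — a datum
`D : V.EigenSelmerDualData 3 _ _ ω γ` (file `IwasawaSelmerEigen`). Periods: `ϖ'·|Ω⁻(E)| = Ω⁻_f`;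
units (signs, powers of `2`) in `u ∈ ℤ₃ˣ`. Hypotheses: `V` globally minimal; semistable at `3` as the
disjunction (good ordinary, `L⁻ = padicLFunctionMinusBranch f α 1`, `α = unitRoot V 3`) ∨ (split,
`L⁻ = padicLFunctionMinusBranchMult f 1 1`) ∨ (non-split multiplicative,
`L⁻ = padicLFunctionMinusBranchMult f (−1) 1`); `V[3]` reducible; `K`, `κ`, `γ`, `f`, `D`, `ϖ'` as
displayed. Conclusion: `Module.IsTorsion Λ D.X ∧ ∃ g ∈ D.charIdeal, ∃ u, ι g = C(u ϖ') · L⁻`. The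
componentwise reading of the accepted siblings `charIdeal_dvd_padicLFunction_cyclotomicThree`
(p206900), `thm16_charIdeal_dvd_[non]splitMultiplicative_cyclotomicThree` (p217659, p218971), flag
`Wu14-Thm16-p3-branch-split`, stopped one multiplication earlier. Named fact; nothing asserted.
**RETIRED as a separate named fact (cell `b2b-bsdres`, referee rulings R118.3 / R119.2, 2026-08-20;
deprecate-and-add):** this `p = 3`, `F = K` special case is a KERNEL CONSEQUENCE of the general-`p`
semistable half-eigenspace reading `Wuthrich2014.thm16_halfEigenCharIdeal_dvd_cyclotomicPrime`
(`ReducibleDivisibilityCyclotomicPrimeHalf.lean`, p235418) — derivation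
`Summit.BirchSwinnertonDyer.Rank1Residual.AdditivePotMult.thm16_minusEigenCharIdeal_dvd_cyclotomicThree_of_half`
(`Summits/BirchSwinnertonDyer/Rank1Residual/AdditivePotMult/CyclotomicThreeOfHalf.lean`, p237434).
New consumers take the general fact; existing consumers migrate to the `…_of_half` form when next
touched; this `def` is kept verbatim only until no module references it, then removed.
[cite: Wuthrich2014, Thm. 16 and §5 (p. 397), §1 Thm. 3 (p. 383), §3 (p. 390), §4 (p. 396), Cor. 18 (p. 398)]
[cite: GreenbergLNM1716, Thm. 1.5 (PDF p. 61) and §5 (p. 143)]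
[cite: MazurTateTeitelbaum1986Invent, §I.10, §I.13] -/
def thm16_minusEigenCharIdeal_dvd_cyclotomicThree : Prop :=
  ∀ (V : WeierstrassCurve ℚ) [V.IsElliptic] [V.IsGloballyMinimal]
    (K : Type) [Field K] [NumberField K] [IsCyclotomicExtension {3} ℚ K]
    [(galRange (K := ℚ) K).Normal]
    {κ : ZpExtension ℚ 3} {γ : Field.absoluteGaloisGroup ℚ} {N : ℕ} [NeZero N]
    {f : CuspForm (Gamma0 N) 2} (Lminus : PowerSeries ℚ_[3]),
    ((IsOrdinaryAt V 3 ∧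
        Lminus = padicLFunctionMinusBranch f ((unitRoot V 3 : ℤ_[3]) : ℚ_[3]) 1) ∨
      (V.HasSplitMultiplicativeReductionAtPrime 3 ∧
        Lminus = padicLFunctionMinusBranchMult f (1 : ℚ_[3]) 1) ∨
      (V.HasMultiplicativeReductionAtPrime 3 ∧ ¬ V.HasSplitMultiplicativeReductionAtPrime 3 ∧
        Lminus = padicLFunctionMinusBranchMult f (-1 : ℚ_[3]) 1)) →
    ¬ V.HasIrreducibleModPGaloisRep 3 →
    κ.IsCyclotomic → κ.IsTopGenerator γ → IsCyclotomicVariable 3 γ →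
    γ ∈ galRange (K := ℚ) K → IsNewformOf V f →
    ∀ (D : V.EigenSelmerDualData 3 (κ.kerSubgroup ⊓ galRange (K := ℚ) K) κ.kerSubgroup
        (fun g ↦ if g ∈ galRange (K := ℚ) K then 1 else -1) γ) (ϖ' : ℚ),
      (ϖ' : ℝ) * V.imaginaryPeriodRat = minusPeriod f →
      Module.IsTorsion (IwasawaAlgebra 3) D.X ∧
      ∃ g ∈ D.charIdeal, ∃ u : ℤ_[3]ˣ,
        iwasawaToPowerSeries 3 g =
          PowerSeries.C (((u : ℤ_[3]) : ℚ_[3]) * (ϖ' : ℚ_[3])) * Lminus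

end Literature.NumberTheory.EllipticCurves.Wuthrich2014

end
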